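import Summits.HubbardSuperconductivity.HubbardSuperconductivity.Theses.AposterioriCapRg
import Literature.MathematicalPhysics.QuantumLattice.XYOrderInfraredProofs

/-!
# Crux `AposterioriOrderCriterionR` (stmt-HubbardSuperconductivity-13884) — ideator 2, round 1: first lemmas of three crux ideas

Sketch only (crux-ideate: no skeleton).  Every declaration is a `Prop` over existing tree declarations;
nothing is asserted.  Cards filed: `scale-induction-peierls` (§C), `grassmann-ward-flow` (§E), `fermions-first-positive-measure` (§F);
§L records two abstract infrared-bound lemmas of a line that was NOT filed (see NOTES.md, dead: f-sum obstruction).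
-/

noncomputable section

namespace Summit.HubbardSuperconductivity.HubbardSuperconductivity.Cruxes.AposterioriOrderCriterionR.Ideator2

open Literature.MathematicalPhysics.QuantumLattice Literature.Probability.LatticeModels Matrix Filter
open scoped ComplexOrder

/-! ## §C  card `scale-induction-peierls`: R = closure of the certificate format under ONE RG octave -/

/-- `CertifiedUpTo U μ D h₁`: ONE datum certified against the CT report at every source `h ∈ (0, h₁]`
(R's hypothesis shape, with the range made a parameter). -/
def CertifiedUpTo (U μ : ℝ) (D : HubbardScaleData) (h₁ : ℝ) : Prop :=
  ∀ h ∈ Set.Ioc (0 : ℝ) h₁, ∃ L₀ : ℕ, D.IsCertifiedEnclosure (hubbardScaleReportCT U μ D h) L₀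

/-- Side condition of the octave step: the pseudo-Goldstone mass `ω_h² = 2 h m₀ / κ` of every source in range
stays below the NEW cutoff `Λ/2` (worst case over the enclosures: `2 h₁ m₀⁺ ≤ κ⁻ (Λ/2)²`).  Above the new
scale the kept singular Cooper kernel is then bounded by `1/(ρ_s q²)`, never by `1/h`. -/
def MassBelowHalfScale (D : HubbardScaleData) (h₁ : ℝ) : Prop :=
  2 * h₁ * (D.meanFieldDensity.snd : ℝ) ≤ (D.compressibility.fst : ℝ) * ((D.scale : ℝ) / 2) ^ 2

/-- FIRST LEMMA / TRANSFER `C⁺` of card `scale-induction-peierls` — ONE RG OCTAVE CLOSES THE CERTIFICATE FORMAT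
AT LARGE STIFFNESS.  There are a one-step constant `c` and a remainder ceiling `η₁` such that a datum certified
on `(0, h₁]` at scale `Λ` with stiffness threshold `K > c`, remainder `≤ η₁` and all source masses below `Λ/2`
yields a datum at scale `Λ/2`, certified on the same source range, with stiffness threshold `2K - 2c`
(the scale-adapted stiffness DOUBLES: `d_eff = 3`), remainder `η/2 + c/K` (irrelevant part halves, new
generation `O(1/K)`), mean-field density lower end degraded by at most the factor `1 - c/K`, and OUTPUT
enclosures of `m₀`, `κ` tight within a factor `2` (prover-made data; this is what makes the octave regime and the
final-step regime overlap from the second octave on — nesting `D'.κ ⊆ D.κ` is NOT required and would be false when the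
route's octave-0 datum is certified to a width below the `O(1/K)` flow of `κ`).  Iterating, `K_n ≥ (7/4)ⁿ K₀` and the winding / large-field sector at octave `n`
is a Peierls term `e^{-c' K_n}` — summable without any vortex-gas resummation. -/
def SingleOctaveClosure : Prop :=
  ∃ c η₁ : ℚ, 0 < c ∧ 0 < η₁ ∧ ∀ (U μ h₁ : ℝ) (D : HubbardScaleData) (K η : ℚ), c < K → η ≤ η₁ →
    D.MeetsThresholds K η → MassBelowHalfScale D h₁ → CertifiedUpTo U μ D h₁ →
    ∃ D' : HubbardScaleData, D'.scale = D.scale / 2 ∧ D'.numPatches = D.numPatches ∧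
      D'.MeetsThresholds (2 * K - 2 * c) (η / 2 + c / K) ∧
      (1 - c / K) * D.meanFieldDensity.fst ≤ D'.meanFieldDensity.fst ∧
      D'.meanFieldDensity.snd ≤ 2 * D'.meanFieldDensity.fst ∧
      D'.compressibility.snd ≤ 2 * D'.compressibility.fst ∧
      CertifiedUpTo U μ D' h₁

/-- The FINAL MASSIVE STEP: once the source mass is comparable with the cutoff (`κ⁺ Λ² ≤ 32 h m₀⁻`, i.e.
`ω_h ≥ Λ/4`), the bosonic sector is gapped at scale `≍ Λ` (phase by the source, amplitude by the gap); the nodal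
Dirac fermions stay gapless but couple only irrelevantly to massive bosons (the solved honeycomb-type problem), and
one convergent integration to `Λ = 0` puts the source density within the factor `1 - c/K` of the certified
mean-field density — for THIS `h`, uniformly in large `L`. -/
def FinalMassiveStep : Prop :=
  ∃ c η₁ : ℚ, 0 < c ∧ 0 < η₁ ∧ ∀ (U μ h : ℝ) (D : HubbardScaleData) (K η : ℚ) (L₀ : ℕ), c < K → η ≤ η₁ →
    0 < h → (D.compressibility.snd : ℝ) * (D.scale : ℝ) ^ 2 ≤ 32 * h * (D.meanFieldDensity.fst : ℝ) →
    D.MeetsThresholds K η → D.IsCertifiedEnclosure (hubbardScaleReportCT U μ D h) L₀ →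
    (1 - (c : ℝ) / K) * (D.meanFieldDensity.fst : ℝ) ≤
      liminf (fun L : ℕ => dWaveSourceDensity (L + 1) U μ h) atTop

/-- Bookkeeping of the induction (pure real arithmetic; it is what fixes `kStar := 8c`): one-step losses
`1 - c/K_j` with `K_{j+1} ≥ 2 K_j - 2c` and `K₀ ≥ 8c` multiply to at least `1/2`. -/
def ProductOfLossesGeHalf : Prop :=
  ∀ (c : ℝ) (K : ℕ → ℝ), 0 < c → 8 * c ≤ K 0 → (∀ j, 2 * K j - 2 * c ≤ K (j + 1)) →
    ∀ n, (1 : ℝ) / 2 ≤ ∏ j ∈ Finset.range n, (1 - c / K j)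

/-- SHAPE OF THE LINE (for triage; not a skeleton): the octave step, the final massive step and the bookkeeping
decide R — for each small `h` run octaves while `MassBelowHalfScale` holds (from the second octave on the data
are prover-made and tight, so the two regimes overlap), then take the final step. -/
def InductionShape : Prop :=
  SingleOctaveClosure → FinalMassiveStep → ProductOfLossesGeHalf →
    Summit.HubbardSuperconductivity.HubbardSuperconductivity.Theses.AposterioriCapRg.AposterioriOrderCriterionR

/-! ## §E  card `grassmann-ward-flow`: the exact `U(1)` Ward identity behind the `1/h` transverse vertex -/

/-- FIRST LEMMA of card `grassmann-ward-flow` (exact, every finite torus): the transverse pair field applied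
to the ground space IS `(H - E₀)` applied to the conserved charge,
`(H_h - E₀) N P₀ = -2h (Δ_d - Δ_d†) P₀` (from `[H_h, N] = -2h(Δ_d - Δ_d†)`, `[N, Δ_d] = -2Δ_d`,
`(H_h - E₀)P₀ = 0`).  Consequently `h · χ_⊥(q = 0) = Re ω(Δ_d)·2/L²·L²…`: the `1/h` of the zero-momentum
transverse Cooper vertex is the image of `N`, not an independent relevant coupling — the identity the
Grassmann flow must reproduce scale by scale (FMRT 1993) to keep the rank-one Cooper pole massless. -/
def TransverseWardIdentity : Prop :=
  ∀ (L : ℕ) [NeZero L] (U μ h : ℝ),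
    (dWaveSourceTorus L U μ h - ((dWaveSourceTorus L U μ h).groundEnergy : ℂ) • 1) *
        (totalNumber : Matrix (Finset (Orb (FermionTorus 2 L))) (Finset (Orb (FermionTorus 2 L))) ℂ) *
        (dWaveSourceTorus L U μ h).groundProj =
      (-(2 * (h : ℂ))) • ((pairField dWaveFormFactor L - (pairField dWaveFormFactor L)ᴴ) *
        (dWaveSourceTorus L U μ h).groundProj)

/-- The susceptibility form of the same identity (Goldstone theorem at `q = 0` in finite volume):
`2h · ω(A (H - E₀) A') …` written without inverses: for the anti-Hermitian transverse field
`T = Δ_d - Δ_d†`, `2h · ω(T† T) = ω((Δ_d + Δ_d†)) - …`; stated here as the trace identity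
`2h · tr(P₀ T† T) = -tr(P₀ [N, T] … )` reduces to `ω(Tᴴ (H-E₀)⁺ T) = ω(Δ_d + Δ_dᴴ)/(2h)`.  We record only the
commutator form `ω([N, T]) = -2 ω(Δ_d + Δ_dᴴ)`, which with `TransverseWardIdentity` gives
`h χ_⊥(0) = 2 Re ω(Δ_d)` (the static transverse susceptibility per volume is the order parameter over `h`). -/
def ChargeTransverseCommutator : Prop :=
  ∀ (L : ℕ) [NeZero L] (U μ h : ℝ),
    (dWaveSourceTorus L U μ h).groundStateFunctional
        ((totalNumber : Matrix (Finset (Orb (FermionTorus 2 L))) (Finset (Orb (FermionTorus 2 L))) ℂ) *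
            (pairField dWaveFormFactor L - (pairField dWaveFormFactor L)ᴴ) -
          (pairField dWaveFormFactor L - (pairField dWaveFormFactor L)ᴴ) * totalNumber) =
      (-2 : ℂ) * (dWaveSourceTorus L U μ h).groundStateFunctional
        (pairField dWaveFormFactor L + (pairField dWaveFormFactor L)ᴴ)

/-! ## §L  (line considered and NOT filed — recorded dead in NOTES.md: for bare lattice-fermion pair modes the double
commutator `ω([V,[H,V]])` is `O(U + t)` per unit moment while the coherent scale is `Δ` or `c|q|`, so a KLS-type
sum-rule assembly cannot decide pairing order of the Hubbard-typed R; spectrally filtered modes lose the local sum rule.)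
The two abstract lemmas are kept because they are true, cheap, and reusable by the spin-model crux [4]. -/

/-- (Unfiled line.) LOCAL Gaussian domination of the ground-state
energy — the inequality of the tree's single RP input `kls_xy_gaussianDomination_ground`, but only for
`|t| < δ`, i.e. exactly a bound `χ_V ≤ Q` on the static susceptibility plus `ω(V) = 0` — already yields the
Kennedy–Lieb–Shastry infrared bound `ω(V²)² ≤ ½ Q ω(V(H-E₀)V)`; the tree's
`Matrix.groundState_infraredBound` assumes all `t` but its proof expands at `t = 0` only.  This is the door
through which a certified / RG-derived susceptibility bound on SHELL pair modes replaces reflection positivity. -/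
def LocalGaussianDominationSuffices : Prop :=
  ∀ (n : Type) [Fintype n] [DecidableEq n] [Nonempty n] (H V : Matrix n n ℂ) (Q δ : ℝ),
    H.IsHermitian → V.IsHermitian → 0 < δ →
    (∀ t : ℝ, |t| < δ →
      H.groundEnergy ≤ (H + (t : ℂ) • V + ((t ^ 2 * Q / 2 : ℝ) : ℂ) • (1 : Matrix n n ℂ)).groundEnergy) →
    (H.groundStateFunctional (V * V)).re ^ 2 ≤
      Q / 2 * (H.groundStateFunctional (V * (H - (H.groundEnergy : ℂ) • 1) * V)).re

/-- Spectral (Landau / phonon-velocity) variant of the input: a gap `γ` of `H - E₀` on an `H`-invariant sector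
`P` (e.g. lattice momentum `q ≠ 0`, even fermion parity) into which `V` maps the ground space bounds the
structure factor by the double commutator with NO Gaussian domination at all:
`γ · ω(V²) ≤ ω(V (H - E₀) V) = ½ ω([V, [H, V]])`, i.e. `S_V(q) ≤ f_V(q) / (2 Gap(q))`. -/
def SectorGapInfraredBound : Prop :=
  ∀ (n : Type) [Fintype n] [DecidableEq n] [Nonempty n] (H V P : Matrix n n ℂ) (γ : ℝ),
    H.IsHermitian → V.IsHermitian → P.IsHermitian → P * P = P → Commute P H →
    V * H.groundProj = P * V * H.groundProj → 0 < γ →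
    (P * (H - (H.groundEnergy : ℂ) • 1 - ((γ : ℝ) : ℂ) • 1) * P).PosSemidef →
    γ * (H.groundStateFunctional (V * V)).re ≤
      (H.groundStateFunctional (V * (H - (H.groundEnergy : ℂ) • 1) * V)).re

/-! ## §F  card `fermions-first-positive-measure`: exact HS of the RANK-ONE kept kernel + TRS positivity -/

/-- FIRST LEMMA of card `fermions-first-positive-measure` (algebraic core of time-reversal positivity of the
singlet BdG / pairing-channel fermion determinant, Wu–Zhang 2005; Koonin–Dean–Langanke 1997): the complex form
`[[A, B], [-B̄, Ā]]` of a quaternionic matrix has REAL NON-NEGATIVE determinant.  Applied to the space–time BdG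
matrix of the normal form's quadratic part in an ARBITRARY complex pairing background `a + φ` (spin-`↓` block =
complex conjugate of spin-`↑` block), it makes the fermion-integrated Hubbard–Stratonovich weight a positive measure
on pair-field configurations (up to the `O(η)` remainder factor). -/
def QuaternionicDetNonneg : Prop :=
  ∀ (n : Type) [Fintype n] [DecidableEq n] (A B : Matrix n n ℂ),
    ((Matrix.fromBlocks A B (-(B.map star)) (A.map star)).det).im = 0 ∧
      0 ≤ ((Matrix.fromBlocks A B (-(B.map star)) (A.map star)).det).re

/-- The REDUCTION SHAPE of card `fermions-first-positive-measure` over the certificate: exact Gaussian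
decoupling of the rank-one kept Cooper kernel (one complex HS variable per pair label with positive coefficient),
exact Grassmann Gaussian integration of `𝒬(q)` in the background `a + φ` (tree: `berezin_grassmannExp_quadratic…`,
`grassmannGaussian_wick`), and a `φ`-uniform convergent expansion of `⟨e^{-R}⟩` on small fields leave a positive
(2+1)-dimensional `O(2)` measure whose Gaussian covariance IS the kept kernel (stiffness `ρ_s`, mass `h/a`) and whose
non-Gaussian part has strength `≲ max(Λ₀/Δ, η, 1/K)`; R for that measure is a magnetisation bound at effective
temperature `1/K`.  Recorded as the implication the card proposes to split R into. -/
def FermionsFirstShape : Prop :=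
  QuaternionicDetNonneg →
    Summit.HubbardSuperconductivity.HubbardSuperconductivity.Theses.AposterioriCapRg.AposterioriOrderCriterionR

end Summit.HubbardSuperconductivity.HubbardSuperconductivity.Cruxes.AposterioriOrderCriterionR.Ideator2
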